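import Literature.NumberTheory.Congruences.DworkCongruencesGhostTerms
import Literature.Combinatorics.Enumerative.AperyNumbers
import Literature.Combinatorics.Enumerative.AperyDworkCongruences
import HarnessLib

/-!
# Dwork congruences for the Apéry numbers `A(n) = Σ_k C(n,k)² C(n+k,k)²` (Straub's Laurent polynomial)

Topic `Literature/Combinatorics/Enumerative`, namespace `Literature.Combinatorics.Enumerative.AperyZetaThreeDworkCongruences`
(companion of `AperyDworkCongruences.lean`, which treats Apéry's `ζ(2)` numbers via Mellit–Vlasenko's two-variable
example; consumer of `Literature/NumberTheory/Congruences/DworkCongruences*.lean`).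

Source, read on the page: A. Straub, *Multivariate Apéry numbers and supercongruences of rational functions*, Algebra
& Number Theory **8** (2014) 1985–2008 = arXiv:1401.0854 [Straub2014], §1, Remark 1.4 (p. 4 of the held arXiv text
`paper:arxiv-1401.0854`): "the Apéry numbers (1) are the constant term of powers of a Laurent polynomial. Namely,
`A(n) = ct[((x_1 + x_2)(x_3 + 1)(x_1 + x_2 + x_3)(x_2 + x_3 + 1))/(x_1 x_2 x_3)]^n`. Since the Newton polyhedron
of this Laurent polynomial has the origin as its only interior integral point, the results of [SvS09], [MV13]
apply to show that `A(n)` satisfies the Dwork congruences `A(p^r m + n) A(⌊n/p⌋) ≡ A(p^{r−1} m + ⌊n/p⌋) A(n)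
(mod p^r)` for all primes `p` and all integers `m, n ≥ 0`, `r ≥ 1`. In particular, `A(p^r m) ≡ A(p^{r−1} m)
(mod p^r)`." Here `A(n) = Σ_{k=0}^{n} C(n,k)² C(n+k,k)²` (Straub's (1); the tree's `AperyNumbers.aperyNumber`), and
[SvS09]/[MV13] are the tree's `samolVanStraten2015_theorem6_holds` / `dwork_congruence`
[SamolVanstraten2015, MellitVlasenko2016].

Everything in this file is PROVED (no named fact):

* `straubLaurent` — `Λ = (x_1 + x_2)(1 + x_3)(x_1 + x_2 + x_3)(1 + x_2 + x_3) · (x_1 x_2 x_3)^{−1} ∈ ℤ[x_1^{±1}, x_2^{±1}, x_3^{±1}]`,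
  built from `numer ∈ ℤ[x_3][x_2][x_1]` through `toLaurent` (`coeff_toLaurent`, `toLaurent_numer`);
* **`ctPow_straubLaurent`** — `[Λ^n]_0 = A(n)`: coefficient extraction gives
  `[x_1^n x_2^n x_3^n] numer^n = Σ_{a ≤ n} C(n,a)² Σ_{c ≤ a} C(n,c) C(a,c) C(2n−c, n−c)` (`coeff_numer_pow`,
  `coeff_middle`, `coeff_inner`), and the binomial identity `Σ_a C(n,a)² C(a,c) = C(n,c) C(2n−c, n−c)`
  (`sum_choose_sq_mul_choose`, from `C(n,a) C(a,c) = C(n,c) C(n−c,a−c)` and Vandermonde) turns this into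
  `Σ_c C(n,c)² C(2n−c,n−c)² = A(n)` (`double_sum_eq_aperyNumber`);
* **`originUnique_straubLaurent`** — "the Newton polyhedron of this Laurent polynomial has the origin as its only
  interior integral point": the numerator is a product of four linear forms with exponents in the unit simplex, so
  (`SuppIn` bookkeeping of `DworkCongruencesGhostTerms`) every exponent `v` of `Λ` has `v_i ≥ −1`, `Σ v_i ≤ 1`
  (`support_straubLaurent_bound`, `newtonPolytope_subset_simplex`); conversely all six `±e_i` are exponents of `Λ`
  (`unit_mem_support`), so the open octahedron `|x|+|y|+|z| < 1` lies in the Newton polytope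
  (`octahedron_subset_newtonPolytope`); an interior lattice point then has coordinates `> −1` with sum `< 1`
  and is tested against the three points `u − (ε/2) e_i` and `u + (ε/4)(1,1,1)`;
* **`aperyNumber_dwork_congruence`** — for every prime `p`, `r ≥ 1`, `m, n ≥ 0`:
  `p^r ∣ A(p^r m + n) A(⌊n/p⌋) − A(p^{r−1} m + ⌊n/p⌋) A(n)` (in `ℤ`); `aperyNumber_dwork_modEq` (the printed
  `(mod p^r)` form) and `aperyNumber_prime_pow_mul_modEq` (the printed special case `A(p^r m) ≡ A(p^{r−1} m)
  (mod p^r)`, `n = 0`).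

Nearest existing declarations (used, not restated): `AperyNumbers.aperyNumber` (+ `aperyNumber_zero`),
`DworkCongruences.{LaurentPoly, ctPow, newtonPolytope, OriginUniqueInteriorLatticePoint, latticeEmb}`,
`DworkCongruencesGhostTerms.{dwork_congruence, SuppIn, SuppIn.add, SuppIn.mul, suppIn_one}`,
`AperyDworkCongruences.latticeEmb_apply`.  Related, different statements in the tree: the Lucas congruences
`AperyLucasCongruences.aperyNumber_modEq_mul` (mod `p`), Gessel's `AperySupercongruences.aperyNumber_modEq_mul_prime`
(`A(pn) ≡ A(n) mod p³`), and Straub's Theorems 1.1/1.2 typed in `MultivariateAperyNumbers` — none of them gives the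
two-term Dwork congruences modulo `p^s` for general `n`.
-/

noncomputable section

open Finset Polynomial Pointwise

namespace Literature.Combinatorics.Enumerative.AperyZetaThreeDworkCongruences

open Literature.NumberTheory.Congruences.DworkCongruences
open Literature.Combinatorics.Enumerative.AperyNumbers (aperyNumber aperyTerm aperyNumber_zero)
open Literature.Combinatorics.Enumerative.AperyDworkCongruences (latticeEmb_apply)

/-! ## A binomial identity -/

/-- `Σ_{a ≤ n} C(n,a)² C(a,c) = C(n,c) C(2n−c, n−c)` (`c ≤ n`): from `C(n,a) C(a,c) = C(n,c) C(n−c, a−c)` and the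
Vandermonde convolution. [cite: Straub2014, §1 Remark 1.4 (the constant-term representation of `A(n)`)] -/
theorem sum_choose_sq_mul_choose {n c : ℕ} (hc : c ≤ n) :
    ∑ a ∈ range (n + 1), n.choose a ^ 2 * a.choose c = n.choose c * (2 * n - c).choose (n - c) := by
  -- terms with `a < c` vanish; reindex `a = c + t`
  have hsplit : ∑ a ∈ range (n + 1), n.choose a ^ 2 * a.choose c =
      ∑ t ∈ range (n - c + 1), n.choose (c + t) ^ 2 * (c + t).choose c := by
    rw [← Finset.sum_range_add_sum_Ico _ (show c ≤ n + 1 by omega)]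
    rw [Finset.sum_eq_zero (fun a ha => by
      rw [Finset.mem_range] at ha; rw [Nat.choose_eq_zero_of_lt ha, mul_zero]), zero_add,
      Finset.sum_Ico_eq_sum_range, show n + 1 - c = n - c + 1 by omega]
  rw [hsplit]
  have hterm : ∀ t ∈ range (n - c + 1),
      n.choose (c + t) ^ 2 * (c + t).choose c = n.choose c * ((n - c).choose t * n.choose (n - c - t)) := by
    intro t ht
    rw [Finset.mem_range] at ht
    have h1 : n.choose (c + t) * (c + t).choose c = n.choose c * (n - c).choose t := by
      rw [Nat.choose_mul (Nat.le_add_right c t), Nat.add_sub_cancel_left]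
    have h2 : n.choose (c + t) = n.choose (n - c - t) := by
      rw [← Nat.choose_symm (show c + t ≤ n by omega)]; congr 1; omega
    calc n.choose (c + t) ^ 2 * (c + t).choose c
        = n.choose (c + t) * (n.choose (c + t) * (c + t).choose c) := by ring
      _ = n.choose (c + t) * (n.choose c * (n - c).choose t) := by rw [h1]
      _ = n.choose c * ((n - c).choose t * n.choose (n - c - t)) := by rw [h2]; ring
  rw [Finset.sum_congr rfl hterm, ← Finset.mul_sum]
  congr 1
  rw [show 2 * n - c = (n - c) + n by omega, Nat.add_choose_eq,
    Finset.Nat.sum_antidiagonal_eq_sum_range_succ_mk]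

/-- `Σ_{a ≤ n} C(n,a)² Σ_{c ≤ a} C(n,c) C(a,c) C(2n−c,n−c) = Σ_k C(n,k)² C(n+k,k)² = A(n)`.
[cite: Straub2014, §1 Remark 1.4] -/
theorem double_sum_eq_aperyNumber (n : ℕ) :
    ∑ a ∈ range (n + 1), n.choose a ^ 2 * ∑ c ∈ range (a + 1), n.choose c * a.choose c * (2 * n - c).choose (n - c) =
      aperyNumber n := by
  -- extend the inner sums to `c ≤ n` and swap
  have hext : ∀ a ∈ range (n + 1),
      n.choose a ^ 2 * ∑ c ∈ range (a + 1), n.choose c * a.choose c * (2 * n - c).choose (n - c) =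
      ∑ c ∈ range (n + 1), n.choose c * (2 * n - c).choose (n - c) * (n.choose a ^ 2 * a.choose c) := by
    intro a ha
    rw [Finset.mem_range] at ha
    rw [Finset.mul_sum, ← Finset.sum_range_add_sum_Ico _ (show a + 1 ≤ n + 1 by omega),
      Finset.sum_eq_zero (s := Ico (a + 1) (n + 1)) (fun c hc => by
        rw [Finset.mem_Ico] at hc; rw [Nat.choose_eq_zero_of_lt (show a < c by omega)]; ring), add_zero]
    exact Finset.sum_congr rfl fun c _ => by ring
  rw [Finset.sum_congr rfl hext, Finset.sum_comm]
  simp_rw [← Finset.mul_sum]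
  rw [aperyNumber, ← Finset.sum_range_reflect _ (n + 1)]
  refine Finset.sum_congr rfl fun c hc => ?_
  rw [Finset.mem_range] at hc
  rw [sum_choose_sq_mul_choose (by omega), Nat.add_sub_cancel, aperyTerm,
    Nat.choose_symm (show c ≤ n by omega), show 2 * n - (n - c) = n + c by omega,
    show n - (n - c) = c by omega]
  ring

/-! ## The Laurent polynomial `Λ = (x_1 + x_2)(1 + x_3)(x_1 + x_2 + x_3)(1 + x_2 + x_3)/(x_1 x_2 x_3)` -/

/-- The exponent vector `(a, b, c) ∈ ℤ³`. [cite: Straub2014, §1 Remark 1.4] -/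
def expVec (a b c : ℤ) : Fin 3 → ℤ := ![a, b, c]

/-- First coordinate. [cite: Straub2014, §1 Remark 1.4] -/
@[simp] theorem expVec_zero (a b c : ℤ) : expVec a b c 0 = a := rfl

/-- Second coordinate. [cite: Straub2014, §1 Remark 1.4] -/
@[simp] theorem expVec_one (a b c : ℤ) : expVec a b c 1 = b := rfl

/-- Third coordinate. [cite: Straub2014, §1 Remark 1.4] -/
@[simp] theorem expVec_two (a b c : ℤ) : expVec a b c 2 = c := rfl

/-- `expVec` is additive. [cite: Straub2014, §1 Remark 1.4] -/
theorem expVec_add (a b c a' b' c' : ℤ) : expVec a b c + expVec a' b' c' = expVec (a + a') (b + b') (c + c') := by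
  ext k; fin_cases k <;> simp

/-- `n • (a, b, c)`. [cite: Straub2014, §1 Remark 1.4] -/
theorem nsmul_expVec (n : ℕ) (a b c : ℤ) : n • expVec a b c = expVec (n * a) (n * b) (n * c) := by
  ext k; fin_cases k <;> simp

/-- `expVec` is injective. [cite: Straub2014, §1 Remark 1.4] -/
theorem expVec_inj {a b c a' b' c' : ℤ} (h : expVec a b c = expVec a' b' c') : a = a' ∧ b = b' ∧ c = c' :=
  ⟨by simpa using congrFun h 0, by simpa using congrFun h 1, by simpa using congrFun h 2⟩

/-- The monomial `x_1`. [cite: Straub2014, §1 Remark 1.4] -/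
def X1 : LaurentPoly ℤ 3 := AddMonoidAlgebra.single (expVec 1 0 0) 1

/-- The monomial `x_2`. [cite: Straub2014, §1 Remark 1.4] -/
def X2 : LaurentPoly ℤ 3 := AddMonoidAlgebra.single (expVec 0 1 0) 1

/-- The monomial `x_3`. [cite: Straub2014, §1 Remark 1.4] -/
def X3 : LaurentPoly ℤ 3 := AddMonoidAlgebra.single (expVec 0 0 1) 1

/-- `ℤ[x_3] → ℤ[x^{±1}]`, `X ↦ x_3`. [cite: Straub2014, §1 Remark 1.4] -/
def toL1 : ℤ[X] →+* LaurentPoly ℤ 3 := Polynomial.eval₂RingHom (Int.castRingHom (LaurentPoly ℤ 3)) X3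

/-- `ℤ[x_3][x_2] → ℤ[x^{±1}]`, `X ↦ x_2`. [cite: Straub2014, §1 Remark 1.4] -/
def toL2 : ℤ[X][X] →+* LaurentPoly ℤ 3 := Polynomial.eval₂RingHom toL1 X2

/-- `ℤ[x_3][x_2][x_1] → ℤ[x^{±1}]`, `X ↦ x_1`. [cite: Straub2014, §1 Remark 1.4] -/
def toLaurent : ℤ[X][X][X] →+* LaurentPoly ℤ 3 := Polynomial.eval₂RingHom toL2 X1

/-- `K1 = 1 + x_3`. [cite: Straub2014, §1 Remark 1.4 (the factor `x_3 + 1`)] -/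
def K1 : ℤ[X] := 1 + X

/-- `K2 = (1 + x_3)²`. [cite: Straub2014, §1 Remark 1.4] -/
def K2 : ℤ[X] := K1 ^ 2

/-- `L2 = 2(1 + x_3)` (`= [x_1 x_2²] numer`). [cite: Straub2014, §1 Remark 1.4] -/
def L2 : ℤ[X] := K1 + K1

/-- `L1 = 2(1 + x_3)² + x_3(1 + x_3)` (`= [x_1 x_2] numer`). [cite: Straub2014, §1 Remark 1.4] -/
def L1 : ℤ[X] := K2 + K2 + K1 * X

/-- `L0 = x_3 (1 + x_3)²` (`= [x_1 x_2⁰] numer = [x_1⁰ x_2] numer`). [cite: Straub2014, §1 Remark 1.4] -/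
def L0 : ℤ[X] := K2 * X

/-- `N2 = (1 + x_3)² + x_3(1 + x_3)` (`= [x_1⁰ x_2²] numer`). [cite: Straub2014, §1 Remark 1.4] -/
def N2 : ℤ[X] := K2 + K1 * X

/-- `Kp = (1 + x_3)(x_2 + x_3 + 1) = (1+x_3) · x_2 + (1+x_3)²` as a polynomial in `x_2` over `ℤ[x_3]`.
[cite: Straub2014, §1 Remark 1.4 (the factors `(x_3 + 1)(x_2 + x_3 + 1)`)] -/
def Kp : ℤ[X][X] := C K1 * X + C K2

/-- `S1 = 2 x_2 + x_3` (`= x_2 + (x_2 + x_3)`). [cite: Straub2014, §1 Remark 1.4] -/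
def S1 : ℤ[X][X] := 2 * X + C X

/-- `S0 = x_2 (x_2 + x_3)`. [cite: Straub2014, §1 Remark 1.4] -/
def S0 : ℤ[X][X] := X ^ 2 + C X * X

/-- `T1 = S1 · Kp = [x_1] numer`. [cite: Straub2014, §1 Remark 1.4] -/
def T1 : ℤ[X][X] := S1 * Kp

/-- `T0 = S0 · Kp = [x_1⁰] numer`. [cite: Straub2014, §1 Remark 1.4] -/
def T0 : ℤ[X][X] := S0 * Kp

/-- The numerator `(x_1 + x_2)(x_1 + x_2 + x_3) · (1 + x_3)(x_2 + x_3 + 1) = Kp x_1² + S1 Kp x_1 + S0 Kp`, as a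
polynomial in `x_1` over `ℤ[x_3][x_2]`. [cite: Straub2014, §1 Remark 1.4] -/
def numer : ℤ[X][X][X] := C Kp * X ^ 2 + C T1 * X + C T0

/-- `Kp = (1+x_3) · (x_2 + (1 + x_3))`. [cite: Straub2014, §1 Remark 1.4] -/
theorem Kp_eq : Kp = C K1 * (X + C K1) := by
  rw [Kp, K2, map_pow]; ring

/-- Factored form: `numer = Kp · (x_1 + x_2)(x_1 + (x_2 + x_3))`. [cite: Straub2014, §1 Remark 1.4] -/
theorem numer_eq : numer = C Kp * ((X + C X) * (X + C (X + C X))) := by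
  simp only [numer, T1, T0, S1, S0, map_add, map_mul, map_pow, map_ofNat]
  ring

/-- `T1 = 2(1+x_3) x_2² + (2(1+x_3)² + x_3(1+x_3)) x_2 + x_3 (1+x_3)²`. [cite: Straub2014, §1 Remark 1.4] -/
theorem T1_eq : T1 = C L2 * X ^ 2 + C L1 * X + C L0 := by
  simp only [T1, S1, Kp, L2, L1, L0, map_add, map_mul]
  ring

/-- `T0 = (1+x_3) x_2³ + ((1+x_3)² + x_3(1+x_3)) x_2² + x_3(1+x_3)² x_2`. [cite: Straub2014, §1 Remark 1.4] -/
theorem T0_eq : T0 = C K1 * X ^ 3 + C N2 * X ^ 2 + C L0 * X := by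
  simp only [T0, S0, Kp, N2, L0, map_add, map_mul]
  ring

/-- Straub's Laurent polynomial `Λ = (x_1 + x_2)(x_3 + 1)(x_1 + x_2 + x_3)(x_2 + x_3 + 1)/(x_1 x_2 x_3)`.
[cite: Straub2014, §1 Remark 1.4] -/
def straubLaurent : LaurentPoly ℤ 3 := toLaurent numer * AddMonoidAlgebra.single (expVec (-1) (-1) (-1)) 1

/-! ## Transport of coefficients along `toLaurent` -/

/-- `toL1 f = Σ_k f_k x_3^k`. [cite: Straub2014, §1 Remark 1.4] -/
theorem toL1_eq_sum (f : ℤ[X]) :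
    toL1 f = ∑ k ∈ f.support, AddMonoidAlgebra.single (expVec 0 0 k) (f.coeff k) := by
  unfold toL1
  rw [Polynomial.coe_eval₂RingHom, eval₂_eq_sum, Polynomial.sum_def]
  refine Finset.sum_congr rfl fun k _ => ?_
  rw [eq_intCast, AddMonoidAlgebra.intCast_def, X3, AddMonoidAlgebra.single_pow, AddMonoidAlgebra.single_mul_single,
    one_pow, mul_one, zero_add, nsmul_expVec]
  simp

/-- `toL2 g = Σ_{j,k} g_{j,k} x_2^j x_3^k`. [cite: Straub2014, §1 Remark 1.4] -/
theorem toL2_eq_sum (g : ℤ[X][X]) :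
    toL2 g = ∑ j ∈ g.support, ∑ k ∈ (g.coeff j).support,
      AddMonoidAlgebra.single (expVec 0 j k) ((g.coeff j).coeff k) := by
  unfold toL2
  rw [Polynomial.coe_eval₂RingHom, eval₂_eq_sum, Polynomial.sum_def]
  refine Finset.sum_congr rfl fun j _ => ?_
  rw [toL1_eq_sum, Finset.sum_mul]
  refine Finset.sum_congr rfl fun k _ => ?_
  rw [X2, AddMonoidAlgebra.single_pow, AddMonoidAlgebra.single_mul_single, one_pow, mul_one, nsmul_expVec,
    expVec_add]
  simp

/-- `toLaurent Q = Σ_{i,j,k} Q_{i,j,k} x_1^i x_2^j x_3^k`. [cite: Straub2014, §1 Remark 1.4] -/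
theorem toLaurent_eq_sum (Q : ℤ[X][X][X]) :
    toLaurent Q = ∑ i ∈ Q.support, ∑ j ∈ (Q.coeff i).support, ∑ k ∈ ((Q.coeff i).coeff j).support,
      AddMonoidAlgebra.single (expVec i j k) (((Q.coeff i).coeff j).coeff k) := by
  unfold toLaurent
  rw [Polynomial.coe_eval₂RingHom, eval₂_eq_sum, Polynomial.sum_def]
  refine Finset.sum_congr rfl fun i _ => ?_
  rw [toL2_eq_sum, Finset.sum_mul]
  refine Finset.sum_congr rfl fun j _ => ?_
  rw [Finset.sum_mul]
  refine Finset.sum_congr rfl fun k _ => ?_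
  rw [X1, AddMonoidAlgebra.single_pow, AddMonoidAlgebra.single_mul_single, one_pow, mul_one, nsmul_expVec,
    expVec_add]
  simp

/-- Coefficients are transported faithfully: `[x_1^i x_2^j x_3^k] toLaurent Q = Q_{i,j,k}`.
[cite: Straub2014, §1 Remark 1.4] -/
theorem coeff_toLaurent (Q : ℤ[X][X][X]) (i j k : ℕ) :
    (toLaurent Q).coeff (expVec i j k) = ((Q.coeff i).coeff j).coeff k := by
  rw [toLaurent_eq_sum, AddMonoidAlgebra.coeff_sum, Finsupp.finsetSum_apply, Finset.sum_eq_single i]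
  · rw [AddMonoidAlgebra.coeff_sum, Finsupp.finsetSum_apply, Finset.sum_eq_single j]
    · rw [AddMonoidAlgebra.coeff_sum, Finsupp.finsetSum_apply, Finset.sum_eq_single k]
      · rw [AddMonoidAlgebra.coeff_single, Finsupp.single_eq_same]
      · intro k' _ hk'
        rw [AddMonoidAlgebra.coeff_single, Finsupp.single_eq_of_ne]
        exact fun h => hk' (by exact_mod_cast (expVec_inj h).2.2.symm)
      · intro hk
        rw [AddMonoidAlgebra.coeff_single, Finsupp.single_eq_same]
        exact Polynomial.notMem_support_iff.1 hk
    · intro j' _ hj'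
      rw [AddMonoidAlgebra.coeff_sum, Finsupp.finsetSum_apply]
      refine Finset.sum_eq_zero fun k' _ => ?_
      rw [AddMonoidAlgebra.coeff_single, Finsupp.single_eq_of_ne]
      exact fun h => hj' (by exact_mod_cast (expVec_inj h).2.1.symm)
    · intro hj
      rw [Polynomial.notMem_support_iff.1 hj]
      simp
  · intro i' _ hi'
    rw [AddMonoidAlgebra.coeff_sum, Finsupp.finsetSum_apply]
    refine Finset.sum_eq_zero fun j' _ => ?_
    rw [AddMonoidAlgebra.coeff_sum, Finsupp.finsetSum_apply]
    refine Finset.sum_eq_zero fun k' _ => ?_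
    rw [AddMonoidAlgebra.coeff_single, Finsupp.single_eq_of_ne]
    exact fun h => hi' (by exact_mod_cast (expVec_inj h).1.symm)
  · intro hi
    rw [Polynomial.notMem_support_iff.1 hi]
    simp

/-- The factorisation of the numerator inside the Laurent ring:
`toLaurent numer = (1 + x_3)(x_2 + 1 + x_3) · (x_1 + x_2)(x_1 + x_2 + x_3)`. [cite: Straub2014, §1 Remark 1.4] -/
theorem toLaurent_numer :
    toLaurent numer = (1 + X3) * (X2 + (1 + X3)) * ((X1 + X2) * (X1 + (X2 + X3))) := by
  simp only [toLaurent, toL2, toL1, numer_eq, Kp_eq, K1, Polynomial.coe_eval₂RingHom, eval₂_mul, eval₂_add,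
    eval₂_C, eval₂_X, eval₂_one]

/-! ## `[Λ^n]_0 = A(n)` -/

/-- Outer extraction: `[x_1^n] numer^n = Kp^n · Σ_{a ≤ n} C(n,a)² x_2^{n−a} (x_2 + x_3)^a`.
[cite: Straub2014, §1 Remark 1.4] -/
theorem coeff_numer_pow (n : ℕ) : (numer ^ n).coeff n =
    Kp ^ n * ∑ a ∈ range (n + 1), ((n.choose a : ℤ[X][X]) * (n.choose a : ℤ[X][X])) *
      (X ^ (n - a) * (X + C X) ^ a) := by
  rw [numer_eq, mul_pow (C Kp), ← map_pow C Kp n, coeff_C_mul, mul_pow (M := ℤ[X][X][X]), coeff_mul,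
    Finset.Nat.sum_antidiagonal_eq_sum_range_succ_mk]
  congr 1
  refine Finset.sum_congr rfl fun a ha => ?_
  rw [Finset.mem_range, Nat.lt_succ_iff] at ha
  simp only
  rw [coeff_X_add_C_pow, coeff_X_add_C_pow, Nat.sub_sub_self ha, Nat.choose_symm ha]
  ring

/-- Middle extraction: `[x_2^n] Kp^n x_2^{n−a} (x_2+x_3)^a = (1+x_3)^n Σ_{c ≤ a} C(n,c) C(a,c) (1+x_3)^{n−c} x_3^c`
(`a ≤ n`). [cite: Straub2014, §1 Remark 1.4] -/
theorem coeff_middle {n a : ℕ} (ha : a ≤ n) :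
    (Kp ^ n * (X ^ (n - a) * (X + C (X : ℤ[X])) ^ a)).coeff n =
      K1 ^ n * ∑ c ∈ range (a + 1), ((n.choose c : ℤ[X]) * (a.choose c : ℤ[X])) * (K1 ^ (n - c) * X ^ c) := by
  rw [Kp_eq, mul_pow, ← map_pow, mul_assoc, coeff_C_mul, mul_left_comm, coeff_X_pow_mul', if_pos (by omega),
    Nat.sub_sub_self ha, coeff_mul ((X + C K1) ^ n) ((X + C (X : ℤ[X])) ^ a) a,
    Finset.Nat.sum_antidiagonal_eq_sum_range_succ_mk]
  congr 1
  refine Finset.sum_congr rfl fun c hc => ?_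
  rw [Finset.mem_range, Nat.lt_succ_iff] at hc
  simp only
  rw [coeff_X_add_C_pow, coeff_X_add_C_pow, Nat.sub_sub_self hc, Nat.choose_symm hc]
  ring

/-- Inner extraction: `[x_3^n] (1+x_3)^n (1+x_3)^{n−c} x_3^c = C(2n−c, n−c)` (`c ≤ n`).
[cite: Straub2014, §1 Remark 1.4] -/
theorem coeff_inner {n c : ℕ} (hc : c ≤ n) :
    (K1 ^ n * (K1 ^ (n - c) * X ^ c)).coeff n = ((2 * n - c).choose (n - c) : ℤ) := by
  rw [← mul_assoc, ← pow_add, coeff_mul_X_pow', if_pos hc, K1, coeff_one_add_X_pow,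
    show n + (n - c) = 2 * n - c by omega]

/-- `[x_1^n x_2^n x_3^n] numer^n = A(n)`. [cite: Straub2014, §1 Remark 1.4 ("`A(n) = ct[…]^n`")] -/
theorem coeff_coeff_coeff_numer_pow (n : ℕ) : (((numer ^ n).coeff n).coeff n).coeff n = (aperyNumber n : ℤ) := by
  rw [coeff_numer_pow, Finset.mul_sum, finsetSum_coeff, finsetSum_coeff, ← double_sum_eq_aperyNumber, Nat.cast_sum]
  refine Finset.sum_congr rfl fun a ha => ?_
  have ha' : a ≤ n := by rw [Finset.mem_range] at ha; omega
  rw [mul_left_comm, ← C_eq_natCast, ← map_mul, coeff_C_mul, coeff_middle ha', ← C_eq_natCast, ← map_mul,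
    coeff_C_mul, Finset.mul_sum, finsetSum_coeff, Nat.cast_mul, Nat.cast_sum, Nat.cast_pow]
  congr 1
  · ring
  refine Finset.sum_congr rfl fun c hc => ?_
  have hc' : c ≤ n := by rw [Finset.mem_range] at hc; omega
  rw [mul_left_comm, ← C_eq_natCast, ← C_eq_natCast, ← map_mul, coeff_C_mul, coeff_inner hc']
  push_cast
  ring

/-- **`[Λ^n]_0 = A(n)`** ("the Apéry numbers are the constant term of powers of a Laurent polynomial").
[cite: Straub2014, §1 Remark 1.4] -/
theorem ctPow_straubLaurent (n : ℕ) : ctPow straubLaurent n = (aperyNumber n : ℤ) := by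
  unfold ctPow constTerm straubLaurent
  rw [mul_pow, ← map_pow, AddMonoidAlgebra.single_pow, one_pow, AddMonoidAlgebra.coeff_mul_single_apply, mul_one,
    nsmul_expVec, zero_add, show -expVec (n * -1) (n * -1) (n * -1) = expVec (n : ℕ) (n : ℕ) (n : ℕ) by
      ext k; fin_cases k <;> simp,
    coeff_toLaurent, coeff_coeff_coeff_numer_pow]

/-! ## The Newton polytope from above: exponents of `Λ` lie in `{x_i ≥ −1, x_1 + x_2 + x_3 ≤ 1}` -/

/-- The unit simplex `{x ≥ 0, x_1 + x_2 + x_3 ≤ 1}` (it contains the exponents `0, e_1, e_2, e_3` of the four linear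
factors of the numerator). [cite: Straub2014, §1 Remark 1.4 (the Newton polyhedron of `Λ`)] -/
def simplexC : Set (Fin 3 → ℝ) := {x | 0 ≤ x 0 ∧ 0 ≤ x 1 ∧ 0 ≤ x 2 ∧ x 0 + x 1 + x 2 ≤ 1}

/-- The unit simplex is convex. [cite: Straub2014, §1 Remark 1.4] -/
theorem convex_simplexC : Convex ℝ simplexC := by
  have h0 : IsLinearMap ℝ (fun x : Fin 3 → ℝ => x 0) := ⟨fun x y => rfl, fun c x => rfl⟩
  have h1 : IsLinearMap ℝ (fun x : Fin 3 → ℝ => x 1) := ⟨fun x y => rfl, fun c x => rfl⟩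
  have h2 : IsLinearMap ℝ (fun x : Fin 3 → ℝ => x 2) := ⟨fun x y => rfl, fun c x => rfl⟩
  have h012 : IsLinearMap ℝ (fun x : Fin 3 → ℝ => x 0 + x 1 + x 2) :=
    ⟨fun x y => by simp only [Pi.add_apply]; ring, fun c x => by simp only [Pi.smul_apply, smul_eq_mul]; ring⟩
  have e : simplexC = {w | 0 ≤ w 0} ∩ {w | 0 ≤ w 1} ∩ {w | 0 ≤ w 2} ∩ {w | w 0 + w 1 + w 2 ≤ 1} := by
    ext x
    simp [simplexC, and_assoc]
  rw [e]
  exact (((convex_halfSpace_ge h0 0).inter (convex_halfSpace_ge h1 0)).inter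
    (convex_halfSpace_ge h2 0)).inter (convex_halfSpace_le h012 1)

/-- `0 ∈ simplexC`. [cite: Straub2014, §1 Remark 1.4] -/
theorem zero_mem_simplexC : (0 : Fin 3 → ℝ) ∈ simplexC := by
  simp [simplexC]

/-- A monomial whose exponent lies in `a · C` has `SuppIn C _ a`. [cite: MellitVlasenko2016, Prop. 1 (iii) (proof)] -/
theorem suppIn_single {C : Set (Fin 3 → ℝ)} {v : Fin 3 → ℤ} {a : ℝ} (hv : latticeEmb 3 v ∈ a • C) (r : ℤ) :
    SuppIn C (AddMonoidAlgebra.single v r : LaurentPoly ℤ 3) a := by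
  intro u hu
  rw [AddMonoidAlgebra.coeff_single] at hu
  have := Finsupp.support_single_subset hu
  rw [Finset.mem_singleton] at this
  rw [this]
  exact hv

/-- `supp x_1 ⊂ simplexC`. [cite: Straub2014, §1 Remark 1.4] -/
theorem suppIn_X1 : SuppIn simplexC X1 1 :=
  suppIn_single (by rw [one_smul]; norm_num [simplexC]) 1

/-- `supp x_2 ⊂ simplexC`. [cite: Straub2014, §1 Remark 1.4] -/
theorem suppIn_X2 : SuppIn simplexC X2 1 :=
  suppIn_single (by rw [one_smul]; norm_num [simplexC]) 1

/-- `supp x_3 ⊂ simplexC`. [cite: Straub2014, §1 Remark 1.4] -/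
theorem suppIn_X3 : SuppIn simplexC X3 1 :=
  suppIn_single (by rw [one_smul]; norm_num [simplexC]) 1

/-- The numerator is a product of four linear forms with exponents in the unit simplex, so its exponents lie in
`4 · simplexC`. [cite: Straub2014, §1 Remark 1.4 (the Newton polyhedron of `Λ`)] -/
theorem suppIn_toLaurent_numer : SuppIn simplexC (toLaurent numer) 4 := by
  have h1 : SuppIn simplexC (1 : LaurentPoly ℤ 3) 1 := suppIn_one zero_mem_simplexC 1
  have hA : SuppIn simplexC (1 + X3) 1 := h1.add suppIn_X3
  have hB : SuppIn simplexC (X2 + (1 + X3)) 1 := suppIn_X2.add hA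
  have hC : SuppIn simplexC (X1 + X2) 1 := suppIn_X1.add suppIn_X2
  have hD : SuppIn simplexC (X1 + (X2 + X3)) 1 := suppIn_X1.add (suppIn_X2.add suppIn_X3)
  have h := (hA.mul convex_simplexC hB zero_le_one zero_le_one).mul convex_simplexC
    (hC.mul convex_simplexC hD zero_le_one zero_le_one) (by norm_num) (by norm_num)
  rw [toLaurent_numer, show (4 : ℝ) = 1 + 1 + (1 + 1) by norm_num]
  exact h

/-- Every exponent `v` of `Λ` satisfies `v_i ≥ −1` and `v_1 + v_2 + v_3 ≤ 1`.
[cite: Straub2014, §1 Remark 1.4 (the Newton polyhedron of `Λ`)] -/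
theorem support_straubLaurent_bound {v : Fin 3 → ℤ} (hv : v ∈ straubLaurent.coeff.support) :
    (-1 : ℝ) ≤ v 0 ∧ (-1 : ℝ) ≤ v 1 ∧ (-1 : ℝ) ≤ v 2 ∧ (v 0 : ℝ) + v 1 + v 2 ≤ 1 := by
  rw [Finsupp.mem_support_iff, straubLaurent, AddMonoidAlgebra.coeff_mul_single_apply, mul_one] at hv
  obtain ⟨y, hy, hy'⟩ := Set.mem_smul_set.1 (suppIn_toLaurent_numer _ (Finsupp.mem_support_iff.2 hv))
  simp only [simplexC, Set.mem_setOf_eq] at hy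
  obtain ⟨hy0, hy1, hy2, hys⟩ := hy
  have e0 := congrFun hy' 0
  have e1 := congrFun hy' 1
  have e2 := congrFun hy' 2
  simp only [Pi.smul_apply, smul_eq_mul, latticeEmb_apply, Pi.add_apply, Pi.neg_apply, expVec_zero, expVec_one,
    expVec_two] at e0 e1 e2
  push_cast at e0 e1 e2
  exact ⟨by linarith, by linarith, by linarith, by linarith⟩

/-- The Newton polytope of `Λ` lies in the simplex `x, y, z ≥ −1`, `x + y + z ≤ 1`.
[cite: Straub2014, §1 Remark 1.4 (the Newton polyhedron of `Λ`)] -/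
theorem newtonPolytope_subset_simplex :
    newtonPolytope straubLaurent ⊆
      {x : Fin 3 → ℝ | -1 ≤ x 0 ∧ -1 ≤ x 1 ∧ -1 ≤ x 2 ∧ x 0 + x 1 + x 2 ≤ 1} := by
  refine convexHull_min ?_ ?_
  · rintro _ ⟨v, hv, rfl⟩
    simpa only [Set.mem_setOf_eq, latticeEmb_apply] using support_straubLaurent_bound hv
  · have h0 : IsLinearMap ℝ (fun x : Fin 3 → ℝ => x 0) := ⟨fun x y => rfl, fun c x => rfl⟩
    have h1 : IsLinearMap ℝ (fun x : Fin 3 → ℝ => x 1) := ⟨fun x y => rfl, fun c x => rfl⟩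
    have h2 : IsLinearMap ℝ (fun x : Fin 3 → ℝ => x 2) := ⟨fun x y => rfl, fun c x => rfl⟩
    have h012 : IsLinearMap ℝ (fun x : Fin 3 → ℝ => x 0 + x 1 + x 2) :=
      ⟨fun x y => by simp only [Pi.add_apply]; ring, fun c x => by simp only [Pi.smul_apply, smul_eq_mul]; ring⟩
    have := (((convex_halfSpace_ge h0 (-1)).inter (convex_halfSpace_ge h1 (-1))).inter
      (convex_halfSpace_ge h2 (-1))).inter (convex_halfSpace_le h012 1)
    convert this using 1
    ext x
    simp [and_assoc]

/-! ## The Newton polytope from below: the six exponents `±e_i` -/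

/-- `[x_1²] numer = Kp`. [cite: Straub2014, §1 Remark 1.4] -/
theorem numer_coeff_two : numer.coeff 2 = Kp := by simp [numer]

/-- `[x_1] numer = T1`. [cite: Straub2014, §1 Remark 1.4] -/
theorem numer_coeff_one : numer.coeff 1 = T1 := by simp [numer]

/-- `[x_1⁰] numer = T0`. [cite: Straub2014, §1 Remark 1.4] -/
theorem numer_coeff_zero : numer.coeff 0 = T0 := by simp [numer]

/-- `[x_2] Kp = 1 + x_3`. [cite: Straub2014, §1 Remark 1.4] -/
theorem Kp_coeff_one : Kp.coeff 1 = K1 := by simp [Kp]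

/-- `[x_2²] T1 = L2`. [cite: Straub2014, §1 Remark 1.4] -/
theorem T1_coeff_two : T1.coeff 2 = L2 := by rw [T1_eq]; simp

/-- `[x_2] T1 = L1`. [cite: Straub2014, §1 Remark 1.4] -/
theorem T1_coeff_one : T1.coeff 1 = L1 := by rw [T1_eq]; simp

/-- `[x_2⁰] T1 = L0`. [cite: Straub2014, §1 Remark 1.4] -/
theorem T1_coeff_zero : T1.coeff 0 = L0 := by rw [T1_eq]; simp

/-- `[x_2] T0 = L0`. [cite: Straub2014, §1 Remark 1.4] -/
theorem T0_coeff_one : T0.coeff 1 = L0 := by rw [T0_eq]; simp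

/-- `[x_3] (1 + x_3) = 1`. [cite: Straub2014, §1 Remark 1.4] -/
theorem K1_coeff_one : K1.coeff 1 = 1 := by simp [K1, coeff_one]

/-- `[x_3^k] (1 + x_3)² = C(2,k)`. [cite: Straub2014, §1 Remark 1.4] -/
theorem K2_coeff (k : ℕ) : K2.coeff k = ((2 : ℕ).choose k : ℤ) := by
  rw [K2, K1, coeff_one_add_X_pow]

/-- `[x_3] L0 = 1`. [cite: Straub2014, §1 Remark 1.4] -/
theorem L0_coeff_one : L0.coeff 1 = 1 := by
  rw [L0, coeff_mul_X, K2_coeff]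
  simp

/-- `[x_3] L2 = 2`. [cite: Straub2014, §1 Remark 1.4] -/
theorem L2_coeff_one : L2.coeff 1 = 2 := by
  rw [L2, coeff_add, K1_coeff_one]
  norm_num

/-- `[x_3²] L1 = 3`. [cite: Straub2014, §1 Remark 1.4] -/
theorem L1_coeff_two : L1.coeff 2 = 3 := by
  rw [L1, coeff_add, coeff_add, coeff_mul_X, K2_coeff, K1_coeff_one]
  simp

/-- `[x_3⁰] L1 = 2`. [cite: Straub2014, §1 Remark 1.4] -/
theorem L1_coeff_zero : L1.coeff 0 = 2 := by
  rw [L1, coeff_add, coeff_add, coeff_mul_X_zero, K2_coeff]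
  simp

/-- Coefficients of `Λ` in terms of the numerator. [cite: Straub2014, §1 Remark 1.4] -/
theorem coeff_straubLaurent_eq (a b c : ℤ) (i j k : ℕ) (ha : a + 1 = i) (hb : b + 1 = j) (hc : c + 1 = k) :
    straubLaurent.coeff (expVec a b c) = ((numer.coeff i).coeff j).coeff k := by
  rw [straubLaurent, AddMonoidAlgebra.coeff_mul_single_apply, mul_one,
    show expVec a b c + -expVec (-1) (-1) (-1) = expVec (i : ℤ) (j : ℤ) (k : ℤ) by
      rw [← ha, ← hb, ← hc]; ext l; fin_cases l <;> simp,
    coeff_toLaurent]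

/-- The six unit exponents `±e_1, ±e_2, ±e_3` lie in the support of `Λ` (coefficients `1, 1, 2, 1, 3, 2`).
[cite: Straub2014, §1 Remark 1.4 (the Newton polyhedron of `Λ`)] -/
theorem unit_mem_support :
    expVec 1 0 0 ∈ straubLaurent.coeff.support ∧ expVec (-1) 0 0 ∈ straubLaurent.coeff.support ∧
    expVec 0 1 0 ∈ straubLaurent.coeff.support ∧ expVec 0 (-1) 0 ∈ straubLaurent.coeff.support ∧
    expVec 0 0 1 ∈ straubLaurent.coeff.support ∧ expVec 0 0 (-1) ∈ straubLaurent.coeff.support := by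
  simp only [Finsupp.mem_support_iff]
  refine ⟨?_, ?_, ?_, ?_, ?_, ?_⟩
  · -- `e_1 ↔ (2,1,1)`
    rw [coeff_straubLaurent_eq 1 0 0 2 1 1 (by norm_num) (by norm_num) (by norm_num), numer_coeff_two,
      Kp_coeff_one, K1_coeff_one]
    exact one_ne_zero
  · -- `−e_1 ↔ (0,1,1)`
    rw [coeff_straubLaurent_eq (-1) 0 0 0 1 1 (by norm_num) (by norm_num) (by norm_num), numer_coeff_zero,
      T0_coeff_one, L0_coeff_one]
    exact one_ne_zero
  · -- `e_2 ↔ (1,2,1)`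
    rw [coeff_straubLaurent_eq 0 1 0 1 2 1 (by norm_num) (by norm_num) (by norm_num), numer_coeff_one,
      T1_coeff_two, L2_coeff_one]
    norm_num
  · -- `−e_2 ↔ (1,0,1)`
    rw [coeff_straubLaurent_eq 0 (-1) 0 1 0 1 (by norm_num) (by norm_num) (by norm_num), numer_coeff_one,
      T1_coeff_zero, L0_coeff_one]
    exact one_ne_zero
  · -- `e_3 ↔ (1,1,2)`
    rw [coeff_straubLaurent_eq 0 0 1 1 1 2 (by norm_num) (by norm_num) (by norm_num), numer_coeff_one,
      T1_coeff_one, L1_coeff_two]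
    norm_num
  · -- `−e_3 ↔ (1,1,0)`
    rw [coeff_straubLaurent_eq 0 0 (-1) 1 1 0 (by norm_num) (by norm_num) (by norm_num), numer_coeff_one,
      T1_coeff_one, L1_coeff_zero]
    norm_num

/-- The open octahedron `|x| + |y| + |z| < 1` lies in the Newton polytope (hull of `±e_i`).
[cite: Straub2014, §1 Remark 1.4 ("the origin as its only interior integral point")] -/
theorem octahedron_subset_newtonPolytope :
    {x : Fin 3 → ℝ | |x 0| + |x 1| + |x 2| < 1} ⊆ newtonPolytope straubLaurent := by
  intro x hx
  rw [Set.mem_setOf_eq] at hx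
  obtain ⟨hP1, hP2, hP3, hP4, hP5, hP6⟩ := unit_mem_support
  have hS : ∀ v ∈ straubLaurent.coeff.support, latticeEmb 3 v ∈ newtonPolytope straubLaurent :=
    fun v hv => subset_convexHull ℝ _ ⟨v, hv, rfl⟩
  set a := x 0
  set b := x 1
  set c := x 2
  set r := 1 - |a| - |b| - |c| with hr
  have hr0 : 0 < r := by linarith
  let w : Fin 6 → ℝ := ![max a 0 + r / 2, max (-a) 0 + r / 2, max b 0, max (-b) 0, max c 0, max (-c) 0]
  let z : Fin 6 → (Fin 3 → ℝ) :=
    ![latticeEmb 3 (expVec 1 0 0), latticeEmb 3 (expVec (-1) 0 0), latticeEmb 3 (expVec 0 1 0),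
      latticeEmb 3 (expVec 0 (-1) 0), latticeEmb 3 (expVec 0 0 1), latticeEmb 3 (expVec 0 0 (-1))]
  have hw0 : ∀ i ∈ (Finset.univ : Finset (Fin 6)), 0 ≤ w i := by
    intro i _
    fin_cases i <;> simp [w] <;> positivity
  have hw1 : ∑ i, w i = 1 := by
    simp only [Fin.sum_univ_succ, Fin.sum_univ_zero, w, Matrix.cons_val_zero, Matrix.cons_val_succ]
    have h1 := max_zero_add_max_neg_zero_eq_abs_self a
    have h2 := max_zero_add_max_neg_zero_eq_abs_self b
    have h3 := max_zero_add_max_neg_zero_eq_abs_self c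
    simp
    linarith
  have hz : ∀ i ∈ (Finset.univ : Finset (Fin 6)), z i ∈ newtonPolytope straubLaurent := by
    intro i _
    fin_cases i
    · exact hS _ hP1
    · exact hS _ hP2
    · exact hS _ hP3
    · exact hS _ hP4
    · exact hS _ hP5
    · exact hS _ hP6
  have hsum : ∑ i, w i • z i = x := by
    have h1 := max_zero_sub_max_neg_zero_eq_self a
    have h2 := max_zero_sub_max_neg_zero_eq_self b
    have h3 := max_zero_sub_max_neg_zero_eq_self c
    ext k
    simp only [Fin.sum_univ_succ, Fin.sum_univ_zero, Finset.sum_apply, Pi.smul_apply, smul_eq_mul]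
    fin_cases k
    · simp [w, z]
      linarith
    · simp [w, z]
      linarith
    · simp [w, z]
      linarith
  have := (convex_convexHull ℝ _).sum_mem hw0 hw1 hz
  rwa [hsum] at this

/-- **"The Newton polyhedron of this Laurent polynomial has the origin as its only interior integral point"** —
the hypothesis `OriginUniqueInteriorLatticePoint` holds for Straub's `Λ`. [cite: Straub2014, §1 Remark 1.4] -/
theorem originUnique_straubLaurent : OriginUniqueInteriorLatticePoint straubLaurent := by
  constructor
  · have hopen : IsOpen {x : Fin 3 → ℝ | |x 0| + |x 1| + |x 2| < 1} :=
      isOpen_lt ((((continuous_apply 0).abs).add ((continuous_apply 1).abs)).add ((continuous_apply 2).abs))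
        continuous_const
    apply interior_mono octahedron_subset_newtonPolytope
    rw [hopen.interior_eq]
    simp
  · intro u hu
    rw [mem_interior_iff_mem_nhds, Metric.mem_nhds_iff] at hu
    obtain ⟨ε, hε, hball⟩ := hu
    have hT : ∀ y ∈ Metric.ball (latticeEmb 3 u) ε,
        y ∈ {x : Fin 3 → ℝ | -1 ≤ x 0 ∧ -1 ≤ x 1 ∧ -1 ≤ x 2 ∧ x 0 + x 1 + x 2 ≤ 1} :=
      fun y hy => newtonPolytope_subset_simplex (hball hy)
    -- test points `u − (ε/2) e_i` and `u + (ε/4)(1,1,1)`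
    have hmem : ∀ (δ0 δ1 δ2 : ℝ), |δ0| < ε → |δ1| < ε → |δ2| < ε →
        (fun k : Fin 3 => (u k : ℝ) + (![δ0, δ1, δ2] : Fin 3 → ℝ) k) ∈ Metric.ball (latticeEmb 3 u) ε := by
      intro δ0 δ1 δ2 h0 h1 h2
      rw [Metric.mem_ball, dist_pi_lt_iff hε]
      intro k
      fin_cases k
      · simpa [Real.dist_eq] using h0
      · simpa [Real.dist_eq] using h1
      · simpa [Real.dist_eq] using h2
    have hε2 : |ε / 2| < ε := by rw [abs_of_pos (by positivity)]; linarith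
    have hε2' : |-(ε / 2)| < ε := by rw [abs_neg]; exact hε2
    have hε4 : |ε / 4| < ε := by rw [abs_of_pos (by positivity)]; linarith
    have h0ε : |(0 : ℝ)| < ε := by simpa using hε
    have t1 := hT _ (hmem (-(ε / 2)) 0 0 hε2' h0ε h0ε)
    have t2 := hT _ (hmem 0 (-(ε / 2)) 0 h0ε hε2' h0ε)
    have t3 := hT _ (hmem 0 0 (-(ε / 2)) h0ε h0ε hε2')
    have t4 := hT _ (hmem (ε / 4) (ε / 4) (ε / 4) hε4 hε4 hε4)
    simp only [Set.mem_setOf_eq, Matrix.cons_val_zero, Matrix.cons_val_one, Matrix.cons_val_two, Matrix.tail_cons,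
      Matrix.head_cons] at t1 t2 t3 t4
    have hu0 : (-1 : ℝ) < u 0 := by linarith [t1.1]
    have hu1 : (-1 : ℝ) < u 1 := by linarith [t2.2.1]
    have hu2 : (-1 : ℝ) < u 2 := by linarith [t3.2.2.1]
    have hu012 : (u 0 : ℝ) + u 1 + u 2 < 1 := by linarith [t4.2.2.2]
    have i0 : (-1 : ℤ) < u 0 := by exact_mod_cast hu0
    have i1 : (-1 : ℤ) < u 1 := by exact_mod_cast hu1
    have i2 : (-1 : ℤ) < u 2 := by exact_mod_cast hu2
    have i012 : u 0 + u 1 + u 2 < 1 := by exact_mod_cast hu012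
    ext k
    fin_cases k
    · show u 0 = 0; omega
    · show u 1 = 0; omega
    · show u 2 = 0; omega

/-! ## The Dwork congruences -/

/-- **Dwork congruences for the Apéry numbers** `A(n) = Σ_k C(n,k)² C(n+k,k)²`, in the printed orientation: for
every prime `p`, `r ≥ 1` and `m, n ≥ 0`, `p^r ∣ A(p^r m + n) A(⌊n/p⌋) − A(p^{r−1} m + ⌊n/p⌋) A(n)`.
[cite: Straub2014, §1 Remark 1.4 ("the results of [SvS09], [MV13] apply to show that `A(n)` satisfies the Dwork
congruences `A(p^r m + n) A(⌊n/p⌋) ≡ A(p^{r−1} m + ⌊n/p⌋) A(n) (mod p^r)`")] -/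
theorem aperyNumber_dwork_congruence {p : ℕ} (hp : p.Prime) {r : ℕ} (hr : 1 ≤ r) (m n : ℕ) :
    (p : ℤ) ^ r ∣ (aperyNumber (p ^ r * m + n) : ℤ) * aperyNumber (n / p) -
      (aperyNumber (p ^ (r - 1) * m + n / p) : ℤ) * aperyNumber n := by
  have hR : ∀ a : ℤ, (p : ℤ) ∣ a ^ p - a := fun a => by
    haveI := Fact.mk hp
    rw [← ZMod.intCast_zmod_eq_zero_iff_dvd]
    push_cast
    rw [ZMod.pow_card, sub_self]
  have h := dwork_congruence hp hR straubLaurent originUnique_straubLaurent hr n m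
  simp only [ctPow_straubLaurent] at h
  rwa [show n + m * p ^ r = p ^ r * m + n by ring, show n / p + m * p ^ (r - 1) = p ^ (r - 1) * m + n / p by ring,
    mul_comm (aperyNumber n : ℤ)] at h

/-- The same as a congruence: `A(p^r m + n) A(⌊n/p⌋) ≡ A(p^{r−1} m + ⌊n/p⌋) A(n) (mod p^r)`.
[cite: Straub2014, §1 Remark 1.4] -/
theorem aperyNumber_dwork_modEq {p : ℕ} (hp : p.Prime) {r : ℕ} (hr : 1 ≤ r) (m n : ℕ) :
    (aperyNumber (p ^ r * m + n) : ℤ) * aperyNumber (n / p) ≡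
      aperyNumber (p ^ (r - 1) * m + n / p) * aperyNumber n [ZMOD (p : ℤ) ^ r] :=
  (Int.modEq_iff_dvd.2 (aperyNumber_dwork_congruence hp hr m n)).symm

/-- "In particular, `A(p^r m) ≡ A(p^{r−1} m) (mod p^r)`" (the case `n = 0`). [cite: Straub2014, §1 Remark 1.4] -/
theorem aperyNumber_prime_pow_mul_modEq {p : ℕ} (hp : p.Prime) {r : ℕ} (hr : 1 ≤ r) (m : ℕ) :
    aperyNumber (p ^ r * m) ≡ aperyNumber (p ^ (r - 1) * m) [MOD p ^ r] := by
  have h := aperyNumber_dwork_modEq hp hr m 0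
  rw [Nat.zero_div, add_zero, add_zero, aperyNumber_zero, Nat.cast_one, mul_one, mul_one, ← Nat.cast_pow] at h
  exact Int.natCast_modEq_iff.1 h

end Literature.Combinatorics.Enumerative.AperyZetaThreeDworkCongruences
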